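import Mathlib
import HarnessLib
import Summits.ResolutionOfSingularities.ResolutionOfSingularities.Theorems.WildQuotientsWildQuotientResolutionBlowupLocalExitAffine
import Literature.AlgebraicGeometry.Resolution.BlowupPrincipalCharts
import Literature.AlgebraicGeometry.Resolution.BlowupChartRatios
import Literature.AlgebraicGeometry.RelativeSpec.FiniteGroupQuotientGluedProperties

/-!
# V3U-F1, brick `HPa`: preliminaries (points of affine opens, transport, the vertex locus on `V[x_a]`)

(crux stmt-ResolutionOfSingularities-15640 `WildQuotients.WildQuotientResolution`, line `Sketch`,
sector `|G| = p`; programme V3U of `L/w45c/CHAIN.md` v6.2 §4.0 row stub-3, helpers for the cone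
brick `HPa` of `ToricExit.jordanThree_hasResolution_of_bricks` (p496627). [OURS · L1 W4.5c] — NOT a
statement of any manuscript; replaces the role of no printed item. Prover res-L1-w45c-stub-3.)

* point-set dictionary on affine opens (`mem_basicOpen_iff_notMem_primeIdealOf`,
  `ΓSpecIso_inv_mem_primeIdealOf_top_iff`), closed images of zero loci under integral maps,
  membership forms of ideal transport along ring isomorphisms;
* `exists_pow_eq_of_isOfFinOrder` (a finite cyclic group is the powers of its generator),
  `map_symm_span_le_iff`, `exists_ringEquiv_subring_subalgebra` (restricting a ring isomorphism to
  a subring whose image is a given subalgebra), `isIntegral_subtype_invariantsRing`,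
  `restrict_act_appLE` (the action of a restricted `ActionOver` on sections versus `appLE`);
* `mem_vertexLocus_iff` — on the principal chart `V[x_a]` of `V = Bl_{(x_a, x_b²)} 𝔸ⁿ`, a point
  `v` lies in `π⁻¹V(x_a, x_b²) ∖ V[x_b²]` iff the prime of `Γ(V, V[x_a])` at `v` contains
  `π^* x_a`, `π^* x_b` and the chart ratio `r` (`π^* x_b² = π^* x_a · r`;
  `IsBlowup.basicOpen_chartRatio`: `D(r) = V[x_a] ∩ V[x_b²]`).
-/

-- single-problem summit: the doubled namespace component `ResolutionOfSingularities` is forced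
set_option linter.dupNamespace false

noncomputable section

open CategoryTheory AlgebraicGeometry TopologicalSpace MvPolynomial
open Literature.AlgebraicGeometry.Resolution Literature.AlgebraicGeometry.RelativeSpec

namespace Summit.ResolutionOfSingularities.ResolutionOfSingularities.Theorems.WildQuotientResolution.ToricExit

/-! ## Two point-set lemmas on affine opens -/

/-- On an affine open `U`, `x ∈ D(s)` iff `s` is not in the prime of `Γ(X, U)` at `x`. [folklore] -/
theorem mem_basicOpen_iff_notMem_primeIdealOf {X : Scheme.{0}} {U : X.Opens} (hU : IsAffineOpen U)
    (s : Γ(X, U)) (x : X) (hx : x ∈ U) :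
    x ∈ X.basicOpen s ↔ s ∉ (hU.primeIdealOf ⟨x, hx⟩).asIdeal := by
  have h1 : x = hU.fromSpec.base (hU.primeIdealOf ⟨x, hx⟩) := (hU.fromSpec_primeIdealOf ⟨x, hx⟩).symm
  constructor
  · intro h
    have h2 : hU.primeIdealOf ⟨x, hx⟩ ∈ hU.fromSpec ⁻¹ᵁ X.basicOpen s := by
      change hU.fromSpec.base (hU.primeIdealOf ⟨x, hx⟩) ∈ X.basicOpen s
      rw [← h1]; exact h
    rw [hU.fromSpec_preimage_basicOpen] at h2
    exact (PrimeSpectrum.mem_basicOpen _ _).mp h2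
  · intro h
    have h2 : hU.primeIdealOf ⟨x, hx⟩ ∈ hU.fromSpec ⁻¹ᵁ X.basicOpen s := by
      rw [hU.fromSpec_preimage_basicOpen]
      exact (PrimeSpectrum.mem_basicOpen _ _).mpr h
    rw [h1]; exact h2

/-- On `Spec S`, the prime of `Γ(Spec S, ⊤)` at a point `x` is `x` read through `ΓSpecIso`.
[folklore] -/
theorem ΓSpecIso_inv_mem_primeIdealOf_top_iff {S : Type} [CommRing S] (x : Spec (CommRingCat.of S))
    (f : S) :
    (Scheme.ΓSpecIso (CommRingCat.of S)).inv.hom f ∈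
        ((isAffineOpen_top (Spec (CommRingCat.of S))).primeIdealOf ⟨x, trivial⟩).asIdeal ↔
      f ∈ x.asIdeal := by
  have h := mem_basicOpen_iff_notMem_primeIdealOf (isAffineOpen_top (Spec (CommRingCat.of S)))
    ((Scheme.ΓSpecIso (CommRingCat.of S)).inv.hom f) x trivial
  have h2 : x ∈ (Spec (CommRingCat.of S)).basicOpen ((Scheme.ΓSpecIso (CommRingCat.of S)).inv.hom f) ↔
      f ∉ x.asIdeal := by
    have e : (Spec (CommRingCat.of S)).basicOpen ((Scheme.ΓSpecIso (CommRingCat.of S)).inv f) =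
        PrimeSpectrum.basicOpen f := basicOpen_eq_of_affine (R := CommRingCat.of S) f
    change x ∈ (Spec (CommRingCat.of S)).basicOpen ((Scheme.ΓSpecIso (CommRingCat.of S)).inv f) ↔ _
    rw [e]
    exact PrimeSpectrum.mem_basicOpen _ _
  tauto

/-- A closed image of a zero locus under `Spec` of an integral extension is the zero locus of the
contraction. [folklore] -/
theorem image_comap_zeroLocus_eq_of_isIntegral {R S : Type} [CommRing R] [CommRing S]
    (f : R →+* S) (hf : f.IsIntegral) (I : Ideal S) :
    PrimeSpectrum.comap f '' PrimeSpectrum.zeroLocus (I : Set S) =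
      PrimeSpectrum.zeroLocus ((I.comap f : Ideal R) : Set R) := by
  rw [← PrimeSpectrum.closure_image_comap_zeroLocus]
  exact ((PrimeSpectrum.isClosedMap_comap_of_isIntegral f hf) _
    (PrimeSpectrum.isClosed_zeroLocus _)).closure_eq.symm

/-- Membership form of an identity `J₀ · Φ = J₁` along a ring isomorphism. [folklore] -/
theorem symm_mem_iff_of_map_eq {R S : Type} [CommRing R] [CommRing S] (Φ : R ≃+* S)
    (J₀ : Ideal R) (J₁ : Ideal S) (h : Ideal.map (Φ : R →+* S) J₀ = J₁) (y : S) :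
    Φ.symm y ∈ J₀ ↔ y ∈ J₁ := by
  rw [← h, Ideal.map_coe, Ideal.symm_apply_mem_of_equiv_iff]

/-- **Regularity of an affine blowing up transfers along a ring isomorphism**, membership form:
for `φ : R ≃ S` and ideals `J₀ ⊆ R`, `J ⊆ S` with `x ∈ J ↔ φ⁻¹ x ∈ J₀`, if `Bl_{J₀}(Spec R)` is regular
then so is `Bl_J(Spec S)` (`BlowupExit.isRegular_affineBlowup_map_ringEquiv`, p489276). [folklore] -/
theorem isRegular_affineBlowup_of_ringEquiv_mem {R S : Type} [CommRing R] [CommRing S]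
    (φ : R ≃+* S) (J₀ : Ideal R) (J : Ideal S) (hJ : ∀ x : S, x ∈ J ↔ φ.symm x ∈ J₀)
    (hreg : Scheme.IsRegular (affineBlowup J₀)) : Scheme.IsRegular (affineBlowup J) := by
  have e : J = J₀.map (φ : R →+* S) := by
    ext x
    rw [hJ, Ideal.map_coe, Ideal.symm_apply_mem_of_equiv_iff]
  rw [e]
  exact BlowupExit.isRegular_affineBlowup_map_ringEquiv φ J₀ hreg

/-! ## Small algebraic helpers -/

/-- In the finite cyclic group `⟨σ⟩` every element is a natural power of the generator. [folklore] -/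
theorem exists_pow_eq_of_isOfFinOrder {M : Type} [Group M] (σ : M) (hfin : IsOfFinOrder σ)
    (g : ↥(Subgroup.zpowers σ)) : ∃ m : ℕ, g = (⟨σ, Subgroup.mem_zpowers σ⟩ : ↥(Subgroup.zpowers σ)) ^ m := by
  obtain ⟨m, hm⟩ := (hfin.mem_powers_iff_mem_zpowers).mpr g.2
  exact ⟨m, Subtype.ext (by rw [Subgroup.coe_pow]; exact hm.symm)⟩

/-- The push-forward of a three-generated ideal along (the inverse of) a ring isomorphism lies in `K`
iff the three images do. [folklore] -/
theorem map_symm_span_le_iff {R₀ E : Type} [CommRing R₀] [CommRing E] (Θ : R₀ ≃+* E)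
    (g₁ g₂ g₃ : E) (K : Ideal R₀) :
    Ideal.map Θ.symm (Ideal.span {g₁, g₂, g₃}) ≤ K ↔ (Θ.symm g₁ ∈ K ∧ Θ.symm g₂ ∈ K ∧ Θ.symm g₃ ∈ K) := by
  constructor
  · intro h
    have hm : ∀ y ∈ ({g₁, g₂, g₃} : Set E), Θ.symm y ∈ K := fun y hy =>
      h (Ideal.mem_map_of_mem Θ.symm (Ideal.subset_span hy))
    exact ⟨hm g₁ (Set.mem_insert _ _), hm g₂ (Set.mem_insert_of_mem _ (Set.mem_insert _ _)),
      hm g₃ (Set.mem_insert_of_mem _ (Set.mem_insert_of_mem _ (Set.mem_singleton _)))⟩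
  · rintro ⟨h1, h2, h3⟩
    refine Ideal.map_le_iff_le_comap.mpr (Ideal.span_le.mpr ?_)
    intro y hy
    simp only [Set.mem_insert_iff, Set.mem_singleton_iff] at hy
    rw [SetLike.mem_coe, Ideal.mem_comap]
    rcases hy with rfl | rfl | rfl
    · exact h1
    · exact h2
    · exact h3

/-- **Restricting a ring isomorphism to a subring with prescribed image.** For a ring isomorphism
`Θ : R₀ ≃ E` onto a subalgebra `E ⊆ S`, a subalgebra `Ec ≤ E`, and a subring `inv ⊆ R₀` with
`x ∈ inv ↔ Θ x ∈ Ec`, there is a ring isomorphism `inv ≃ Ec` under `Θ`. [folklore] -/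
theorem exists_ringEquiv_subring_subalgebra {R₀ k S : Type} [CommRing R₀] [Field k] [CommRing S]
    [Algebra k S] {E Ec : Subalgebra k S} (hle : Ec ≤ E) (Θ : R₀ ≃+* ↥E) (inv : Subring R₀)
    (h : ∀ x : R₀, x ∈ inv ↔ ((Θ x : ↥E) : S) ∈ Ec) :
    ∃ Φ : ↥inv ≃+* ↥Ec, ∀ x : ↥inv, ((Φ x : ↥Ec) : S) = ((Θ x.1 : ↥E) : S) := by
  let f₂ : ↥inv →+* S := ((E.val : ↥E →+* S).comp Θ.toRingHom).comp inv.subtype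
  have hf₂ : ∀ x : inv, f₂ x = ((Θ x.1 : ↥E) : S) := fun x => rfl
  have hf₂mem : ∀ x : inv, f₂ x ∈ Ec := fun x => by rw [hf₂]; exact (h x.1).mp x.2
  let φ₀ : ↥inv →+* ↥Ec :=
    { toFun := fun x => ⟨f₂ x, hf₂mem x⟩
      map_one' := by apply Subtype.ext; change f₂ 1 = 1; exact map_one f₂
      map_mul' := fun x y => by
        apply Subtype.ext; change f₂ (x * y) = f₂ x * f₂ y; exact map_mul f₂ x y
      map_zero' := by apply Subtype.ext; change f₂ 0 = 0; exact map_zero f₂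
      map_add' := fun x y => by
        apply Subtype.ext; change f₂ (x + y) = f₂ x + f₂ y; exact map_add f₂ x y }
  have hφ₀ : ∀ x : inv, ((φ₀ x : ↥Ec) : S) = ((Θ x.1 : ↥E) : S) := fun x => hf₂ x
  have hbij : Function.Bijective φ₀ := by
    constructor
    · intro x y hxy
      have h1 : ((Θ x.1 : ↥E) : S) = ((Θ y.1 : ↥E) : S) := by rw [← hφ₀, ← hφ₀, hxy]
      exact Subtype.ext (Θ.injective (Subtype.ext h1))
    · intro y
      have hy : Θ.symm ⟨y.1, hle y.2⟩ ∈ inv := by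
        rw [h, RingEquiv.apply_symm_apply]; exact y.2
      refine ⟨⟨Θ.symm ⟨y.1, hle y.2⟩, hy⟩, Subtype.ext ?_⟩
      rw [hφ₀]
      change ((Θ (Θ.symm ⟨y.1, hle y.2⟩) : ↥E) : S) = y.1
      rw [RingEquiv.apply_symm_apply]
  exact ⟨RingEquiv.ofBijective φ₀ hbij, fun x =>
    (congrArg Subtype.val (RingEquiv.ofBijective_apply φ₀ hbij x)).trans (hφ₀ x)⟩

/-- The ring of invariants of a finite group acting over a base is integrally closed under the
sections: `Γ(X, r⁻¹U)^G ⊆ Γ(X, r⁻¹U)` is an integral extension. [folklore] -/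
theorem isIntegral_subtype_invariantsRing {X Y : Scheme.{0}} {r : X ⟶ Y} {G : Type} [Group G]
    [Finite G] (ρ : ActionOver r G) (U : Y.Opens) : (ρ.invariantsRing U).subtype.IsIntegral := by
  letI := ρ.mulSemiringAction U
  haveI := ρ.isInvariant_invariantsRing U
  haveI : Algebra.IsIntegral ↥(ρ.invariantsRing U) Γ(X, r ⁻¹ᵁ U) :=
    Algebra.IsInvariant.isIntegral ↥(ρ.invariantsRing U) Γ(X, r ⁻¹ᵁ U) G
  intro x
  exact Algebra.IsIntegral.isIntegral (R := ↥(ρ.invariantsRing U)) x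

/-- **The restricted action on sections versus `appLE`**: for a `G`-stable open `O`, the action of
`g` on `Γ(O, (O → Y)⁻¹⊤)` for `ρ.restrict O` is, through `O ↪ X`, the pull-back along `g⁻¹`
on `Γ(X, O)`. [folklore] -/
theorem restrict_act_appLE {X Y : Scheme.{0}} {r : X ⟶ Y} {G : Type} [Group G] (ρ : ActionOver r G)
    (O : X.Opens) (hO : ∀ g : G, (ρ.aut g).hom ⁻¹ᵁ O = O)
    (hle : (O.ι ≫ r) ⁻¹ᵁ ⊤ ≤ O.ι ⁻¹ᵁ O) (g : G) (s : Γ(X, O)) :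
    (ρ.restrict O hO).act g ⊤ ((O.ι.appLE O ((O.ι ≫ r) ⁻¹ᵁ ⊤) hle).hom s) =
      (O.ι.appLE O ((O.ι ≫ r) ⁻¹ᵁ ⊤) hle).hom
        (((ρ.aut g⁻¹).hom.appLE O O (hO g⁻¹).ge).hom s) := by
  rw [ActionOver.act_apply, ← CommRingCat.comp_apply, ← CommRingCat.comp_apply,
    Scheme.Hom.appLE_comp_appLE, Scheme.Hom.appLE_comp_appLE]
  have hι : ((ρ.restrict O hO).aut g⁻¹).hom ≫ O.ι = O.ι ≫ (ρ.aut g⁻¹).hom :=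
    ρ.restrictHom_ι O hO g⁻¹
  rw [appLE_congr_hom hι]

/-! ## The vertex locus on the principal chart `V[x_a]` of `Bl_{(x_a, x_b²)} 𝔸ⁿ` -/

set_option maxHeartbeats 800000 in
-- the statement alone (intrinsic charts of a Proj scheme) is heavy to elaborate
/-- **Points of `π⁻¹V(x_a, x_b²) ∖ V[x_b²]` inside `V[x_a]`.** For `V = Bl_{(x_a, x_b²)} 𝔸ⁿ` with its
intrinsic principal charts `V[x_a]`, `V[x_b²]` and the chart ratio `r ∈ Γ(V, V[x_a])`
(`π^* x_b² = π^* x_a · r`), a point `v ∈ V[x_a]` lies in `π⁻¹V(x_a, x_b²) ∖ V[x_b²]` iff the prime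
of `Γ(V, V[x_a])` at `v` contains `π^* x_a`, `π^* x_b` and `r` (`D(r) = V[x_a] ∩ V[x_b²]`,
`IsBlowup.basicOpen_chartRatio`). [OURS · L1 W4.5c] [folklore] -/
theorem mem_vertexLocus_iff (k : Type) [Field k] (n : ℕ) (a b : Fin n)
    (hO : IsAffineOpen (blowupChart
      (affineBlowup.π (Ideal.span (Set.range (![X a, X b ^ 2] : Fin 2 → MvPolynomial (Fin n) k))))
      (affineBlowup.idealSheaf (Ideal.span (Set.range (![X a, X b ^ 2] :
        Fin 2 → MvPolynomial (Fin n) k))))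
      ⟨⊤, isAffineOpen_top _⟩
      ((Scheme.ΓSpecIso (CommRingCat.of (MvPolynomial (Fin n) k))).inv.hom (X a))))
    (rV : Γ(affineBlowup (Ideal.span (Set.range (![X a, X b ^ 2] : Fin 2 → MvPolynomial (Fin n) k))),
      blowupChart
        (affineBlowup.π (Ideal.span (Set.range (![X a, X b ^ 2] : Fin 2 → MvPolynomial (Fin n) k))))
        (affineBlowup.idealSheaf (Ideal.span (Set.range (![X a, X b ^ 2] :
          Fin 2 → MvPolynomial (Fin n) k))))
        ⟨⊤, isAffineOpen_top _⟩
        ((Scheme.ΓSpecIso (CommRingCat.of (MvPolynomial (Fin n) k))).inv.hom (X a))))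
    (hrV : (affineBlowup.π (Ideal.span (Set.range (![X a, X b ^ 2] :
        Fin 2 → MvPolynomial (Fin n) k)))).appLE ⊤ _ (blowupChart_le_preimage _ _ _ _)
        ((Scheme.ΓSpecIso (CommRingCat.of (MvPolynomial (Fin n) k))).inv.hom (X b ^ 2)) =
      (affineBlowup.π (Ideal.span (Set.range (![X a, X b ^ 2] :
        Fin 2 → MvPolynomial (Fin n) k)))).appLE ⊤ _ (blowupChart_le_preimage _ _ _ _)
        ((Scheme.ΓSpecIso (CommRingCat.of (MvPolynomial (Fin n) k))).inv.hom (X a)) * rV)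
    (v : ↑(affineBlowup (Ideal.span (Set.range (![X a, X b ^ 2] :
      Fin 2 → MvPolynomial (Fin n) k)))))
    (hv : v ∈ blowupChart
      (affineBlowup.π (Ideal.span (Set.range (![X a, X b ^ 2] : Fin 2 → MvPolynomial (Fin n) k))))
      (affineBlowup.idealSheaf (Ideal.span (Set.range (![X a, X b ^ 2] :
        Fin 2 → MvPolynomial (Fin n) k))))
      ⟨⊤, isAffineOpen_top _⟩
      ((Scheme.ΓSpecIso (CommRingCat.of (MvPolynomial (Fin n) k))).inv.hom (X a))) :
    v ∈ ({v | (affineBlowup.π (Ideal.span (Set.range (![X a, X b ^ 2] :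
            Fin 2 → MvPolynomial (Fin n) k)))).base v ∈
            PrimeSpectrum.zeroLocus (Ideal.span (Set.range (![X a, X b ^ 2] :
              Fin 2 → MvPolynomial (Fin n) k)) : Set (MvPolynomial (Fin n) k))} \
          (blowupChart
            (affineBlowup.π (Ideal.span (Set.range (![X a, X b ^ 2] :
              Fin 2 → MvPolynomial (Fin n) k))))
            (affineBlowup.idealSheaf (Ideal.span (Set.range (![X a, X b ^ 2] :
              Fin 2 → MvPolynomial (Fin n) k))))
            ⟨⊤, isAffineOpen_top _⟩
            ((Scheme.ΓSpecIso (CommRingCat.of (MvPolynomial (Fin n) k))).inv.hom (X b ^ 2)) :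
              Set _)) ↔
      ((affineBlowup.π (Ideal.span (Set.range (![X a, X b ^ 2] :
          Fin 2 → MvPolynomial (Fin n) k)))).appLE ⊤ _ (blowupChart_le_preimage _ _ _ _)
          ((Scheme.ΓSpecIso (CommRingCat.of (MvPolynomial (Fin n) k))).inv.hom (X a)) ∈
            (hO.primeIdealOf ⟨v, hv⟩).asIdeal ∧
        (affineBlowup.π (Ideal.span (Set.range (![X a, X b ^ 2] :
          Fin 2 → MvPolynomial (Fin n) k)))).appLE ⊤ _ (blowupChart_le_preimage _ _ _ _)
          ((Scheme.ΓSpecIso (CommRingCat.of (MvPolynomial (Fin n) k))).inv.hom (X b)) ∈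
            (hO.primeIdealOf ⟨v, hv⟩).asIdeal ∧
        rV ∈ (hO.primeIdealOf ⟨v, hv⟩).asIdeal) := by
  classical
  let S : Type := MvPolynomial (Fin n) k
  let I₂ : Ideal S := Ideal.span (Set.range (![X a, X b ^ 2] : Fin 2 → S))
  have hπ : IsBlowup (affineBlowup.π I₂) (affineBlowup.idealSheaf I₂) := affineBlowup.isBlowup I₂
  let ι₀ : S →+* Γ(Spec (CommRingCat.of S), ⊤) := (Scheme.ΓSpecIso (CommRingCat.of S)).inv.hom
  have hIdeal : (affineBlowup.idealSheaf I₂).ideal ⟨⊤, isAffineOpen_top _⟩ = I₂.map ι₀ := by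
    change (Scheme.IdealSheafData.ofIdealTop _).ideal ⟨⊤, isAffineOpen_top _⟩ = _
    rw [ideal_ofIdealTop_top]
  have hxa : ι₀ (X a) ∈ (affineBlowup.idealSheaf I₂).ideal ⟨⊤, isAffineOpen_top _⟩ := by
    rw [hIdeal]; exact Ideal.mem_map_of_mem _ (Ideal.subset_span ⟨0, rfl⟩)
  have hxb : ι₀ (X b ^ 2) ∈ (affineBlowup.idealSheaf I₂).ideal ⟨⊤, isAffineOpen_top _⟩ := by
    rw [hIdeal]; exact Ideal.mem_map_of_mem _ (Ideal.subset_span ⟨1, rfl⟩)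
  let chartA := blowupChart (affineBlowup.π I₂) (affineBlowup.idealSheaf I₂)
    ⟨⊤, isAffineOpen_top _⟩ (ι₀ (X a))
  let chartB := blowupChart (affineBlowup.π I₂) (affineBlowup.idealSheaf I₂)
    ⟨⊤, isAffineOpen_top _⟩ (ι₀ (X b ^ 2))
  have hleπ : chartA ≤ affineBlowup.π I₂ ⁻¹ᵁ ((⟨⊤, isAffineOpen_top _⟩ :
      (Spec (CommRingCat.of S)).affineOpens) : (Spec (CommRingCat.of S)).Opens) :=
    blowupChart_le_preimage _ _ _ _
  let pb : S → Γ(affineBlowup I₂, chartA) := fun f =>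
    ((affineBlowup.π I₂).appLE ⊤ chartA hleπ (ι₀ f))
  -- points of `V[x_a]` and primes of `Γ(V, V[x_a])`
  have hpt_pb : ∀ f : S,
      pb f ∈ (hO.primeIdealOf ⟨v, hv⟩).asIdeal ↔ f ∈ ((affineBlowup.π I₂).base v).asIdeal := by
    intro f
    have h1 := IsAffineOpen.comap_primeIdealOf_appLE (f := affineBlowup.π I₂) (x := v)
      ((⊤ : (Spec (CommRingCat.of S)).Opens)) (isAffineOpen_top _) chartA hO hleπ hv
    have h2 : ι₀ f ∈ Ideal.comap ((affineBlowup.π I₂).appLE ⊤ chartA hleπ).hom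
        (hO.primeIdealOf ⟨v, hv⟩).asIdeal ↔ f ∈ ((affineBlowup.π I₂).base v).asIdeal := by
      rw [← PrimeSpectrum.comap_asIdeal, h1]
      exact ΓSpecIso_inv_mem_primeIdealOf_top_iff _ f
    exact Ideal.mem_comap.symm.trans h2
  have hbo : (affineBlowup I₂).basicOpen rV = chartA ⊓ chartB :=
    hπ.basicOpen_chartRatio ⟨⊤, isAffineOpen_top _⟩ hxa hxb hrV
  have hpt_r : v ∈ chartB ↔ rV ∉ (hO.primeIdealOf ⟨v, hv⟩).asIdeal := by
    rewrite [← mem_basicOpen_iff_notMem_primeIdealOf hO rV v hv, hbo]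
    exact ⟨fun h => ⟨hv, h⟩, fun h => h.2⟩
  have hzero : (affineBlowup.π I₂).base v ∈ PrimeSpectrum.zeroLocus (I₂ : Set S) ↔
      ((X a : S) ∈ ((affineBlowup.π I₂).base v).asIdeal ∧
        (X b : S) ∈ ((affineBlowup.π I₂).base v).asIdeal) := by
    have hprime := ((affineBlowup.π I₂).base v).isPrime
    constructor
    · intro h
      have h' : I₂ ≤ ((affineBlowup.π I₂).base v).asIdeal := SetLike.coe_subset_coe.mp h
      exact ⟨h' (Ideal.subset_span ⟨0, rfl⟩),
        hprime.mem_of_pow_mem 2 (h' (Ideal.subset_span ⟨1, rfl⟩))⟩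
    · rintro ⟨hXa, hXb⟩
      refine SetLike.coe_subset_coe.mpr (Ideal.span_le.mpr (Set.range_subset_iff.mpr ?_))
      exact Fin.forall_fin_two.mpr ⟨hXa, Ideal.pow_mem_of_mem _ hXb 2 two_pos⟩
  constructor
  · intro h
    simp only [Set.mem_sdiff, Set.mem_setOf_eq, SetLike.mem_coe] at h
    obtain ⟨ha', hb'⟩ := hzero.mp h.1
    refine ⟨(hpt_pb (X a)).mpr ha', (hpt_pb (X b)).mpr hb', ?_⟩
    by_contra hr
    exact h.2 (hpt_r.mpr hr)
  · rintro ⟨ha', hb', hr'⟩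
    simp only [Set.mem_sdiff, Set.mem_setOf_eq, SetLike.mem_coe]
    exact ⟨hzero.mpr ⟨(hpt_pb (X a)).mp ha', (hpt_pb (X b)).mp hb'⟩, fun h => hpt_r.mp h hr'⟩

end Summit.ResolutionOfSingularities.ResolutionOfSingularities.Theorems.WildQuotientResolution.ToricExit

end
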